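import Summits.QuantumFields.YangMills.Theorems.ColdStartUniversalityLatticeLangevinLezaudAbstract
import Summits.QuantumFields.YangMills.Theorems.ColdStartUniversalityLatticeLangevinHypercontractiveColdStart
import HarnessLib

/-!
# Route `ColdStartUniversality` (fixed-cut-off SZZ dynamics, sampler statistics): LEZAUD'S BERNSTEIN INEQUALITY AT EVERY `(L, β')` —
# explicit Holley–Stroock constants (gap `(3/2)e^{−4|β'|#𝒫}`, burn-in `log B ≤ 2e^{−4|β'|#𝒫}t₀`)

Helper file (seat `ym-line-csu-p1`, g37; `--supports stmt-QuantumFields-24809`).  SU(2) lattice Langevin dynamics of Shen–Zhu–Zhu at ANY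
`(L, β')`, Wilson measure `μ = μ_{β'}`.  The abstract continuous-time Lezaud bound (`…LezaudAbstract`: gap `λ` + `L²`-warm start `D`) is
instantiated with the tree's UNCONDITIONAL constants at every coupling: the Holley–Stroock `L²` gap `λ_L = (3/2)e^{−|β'|·4·#𝒫}`
(`wilson_spectralGap_explicit_measurable`, g19) and the warm start delivered by the Holley–Stroock log-Sobolev constant `ρ_L = ½e^{−|β'|·4·#𝒫}`
after the hypercontractive burn-in `log B ≤ 4ρ_L t₀` (`B = 96|β'|#E + 10|β'|#𝒫 + log 2 + #E·log(3/2)`, g27/g36):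

* ★★ `coldStart_warmStart_explicit` — `|E φ(U_{2+t₀+u})| ≤ e · (∫ φ² dμ_{β'})^{1/2}` for all bounded measurable `φ`, every `(L, β')`;
* ★★★ `coldStart_timeAverage_tail_le_bernstein_explicit` — for EVERY bounded continuous `G` with `|G − μG| ≤ b`, `Var_μ(G) ≤ σ²`, every
  strong solution from a deterministic start, `T > 0`, `ε > 0`:
  `P[ T⁻¹∫_{(0,T]} G(U_{2+t₀+u+r}) dr − μ_{β'}G ≥ ε ] ≤ e · exp(−λ_L·T·ε²/(4σ² + 2bε))`.

HONEST FRAMING: at a general `β'` the constants `λ_L, ρ_L` are `e^{−O(|β'|L³)}` (Holley–Stroock from Haar) — this is the SHAPE of a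
Bernstein inequality at every coupling, quantitatively useful only in the window `|β'| < 1/12` (`…LezaudBernstein`, volume-free); RECORD-rung
R3 plumbing at FIXED cut-off; nothing K-uniform; `UniformColdStartMixing` (24809) is NOT restated; no crux, rung or summit statement is proved;
the Yang–Mills mass gap is NOT proved. [cite: Lezaud2001, Theorem 1.1 and Remark 1.2] [cite: DiaconisSaloffcoste1996, Theorem 3.7]
THEOREMS ONLY, no definition, no sorry.
-/

set_option autoImplicit false

noncomputable section

namespace Summit.QuantumFields.YangMills.Theorems.ColdStartUniversality

open MeasureTheory ProbabilityTheory Filter Set Topology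
open scoped BigOperators NNReal ENNReal
open Literature.Probability.Process Literature.MathematicalPhysics.QuantumFieldTheory
open Literature.MathematicalPhysics.QuantumLattice (fundamentalRep fundamentalLatticeRep continuous_fundamentalRep)

variable {L : ℕ} [NeZero L]

/-- ★★ **`L²`-warm start along the cold-start trajectory at EVERY `(L, β')`** (Holley–Stroock log-Sobolev constant
`ρ_L = ½e^{−|β'|·4·#𝒫}`): for every deterministic start `z`, EVERY strong solution `U` from `z`, every bounded measurable `φ`, all `t₀, u`
with `log B ≤ 4ρ_L t₀`:  `|E φ(U_{2+t₀+u})| ≤ e · (∫ φ² dμ_{β'})^{1/2}`. [cite: DiaconisSaloffcoste1996, Theorem 3.7] -/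
theorem coldStart_warmStart_explicit (L : ℕ) [NeZero L] (β' : ℝ)
    (z : GaugeConfig 3 L (Matrix.specialUnitaryGroup (Fin 2) ℂ))
    {Ω : Type} [MeasurableSpace Ω] {P : Measure Ω} [IsProbabilityMeasure P]
    {W : ℝ≥0 → Ω → (Edge 3 L × NoiseIdx 2 → ℝ)} (hW : IsFlatBrownian W P)
    {U : ℝ≥0 → Ω → GaugeConfig 3 L (Matrix.specialUnitaryGroup (Fin 2) ℂ)} (hU0 : ∀ ω, U 0 ω = z)
    (hU : (latticeLangevinDynamics (fundamentalLatticeRep 2) β').IsSolution (fundamentalRep (Fin 2)) hW.natFiltration P W U)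
    {φ : GaugeConfig 3 L (Matrix.specialUnitaryGroup (Fin 2) ℂ) → ℝ} (hφ : Measurable φ) {M : ℝ} (hM : ∀ x, |φ x| ≤ M) (t₀ u : ℝ≥0)
    (ht₀ : Real.log (96 * |β'| * (Fintype.card (Edge 3 L) : ℝ) + 10 * |β'| * (Fintype.card (Plaquette 3 L) : ℝ) + Real.log 2 +
      (Fintype.card (Edge 3 L) : ℝ) * Real.log (3 / 2)) ≤
        4 * ((1 / 2 : ℝ) * Real.exp (-(|β'| * (4 * (Fintype.card (Plaquette 3 L) : ℝ))))) * t₀) :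
    |∫ ω, φ (U (2 + t₀ + u) ω) ∂P| ≤ Real.exp 1 * (∫ x, φ x ^ 2 ∂(wilsonMeasure (d := 3) (L := L) (fundamentalRep (Fin 2)) β')) ^ (1 / (2 : ℝ)) := by
  classical
  haveI := secondCountableTopology_su2
  haveI := borelSpace_config L
  haveI : IsProbabilityMeasure (wilsonMeasure (d := 3) (L := L) (fundamentalRep (Fin 2)) β') :=
    isProbabilityMeasure_wilsonMeasure (d := 3) (L := L) (fundamentalRep (Fin 2)) (continuous_fundamentalRep (Fin 2)) β'
  obtain ⟨κ, hκM, -, hreal⟩ := exists_transitionKernel L β'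
  haveI := hκM
  obtain ⟨hDe, hlogD⟩ := coldStart_density_constant_facts L β'
  obtain ⟨D, hDdef⟩ : ∃ D : ℝ, (Real.exp ((48 * |β'| * (Fintype.card (Edge 3 L) : ℝ)) * ((2 : ℝ≥0) : ℝ) +
      (2 * |β'| * (Fintype.card (Plaquette 3 L) : ℝ))) * (2 * (3 / 2 : ℝ) ^ Fintype.card (Edge 3 L))) *
      (Real.exp (|β'| * (4 * (Fintype.card (Plaquette 3 L) : ℝ))) * Real.exp (|β'| * (4 * (Fintype.card (Plaquette 3 L) : ℝ)))) = D :=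
    ⟨_, rfl⟩
  rw [hDdef] at hDe hlogD
  have hle₁ := map_le_smul_haar_explicit (L := L) β' (t := 2) (by norm_num) z hW hU0 hU
  obtain ⟨-, hπle⟩ := wilsonMeasure_le_smul_pi_haar_and_explicit (L := L) β'
  have hν : P.map (U 2) ≤ (ENNReal.ofReal D) • (wilsonMeasure (d := 3) (L := L) (fundamentalRep (Fin 2)) β') := by
    rw [← hDdef, ENNReal.ofReal_mul (by positivity), Measure.le_iff]
    intro A hA
    have e1 := Measure.le_iff.1 hle₁ A hA
    have e2 := Measure.le_iff.1 hπle A hA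
    simp only [Measure.smul_apply, smul_eq_mul] at e1 e2 ⊢
    calc (P.map (U 2)) A ≤ _ := e1
      _ ≤ _ := mul_le_mul' le_rfl e2
      _ = _ := (mul_assoc _ _ _).symm
  have hmU : ∀ r : ℝ≥0, Measurable (U r) := fun r => (hU.adapted r).mono (hW.natFiltration.le r) le_rfl
  haveI : IsProbabilityMeasure (P.map (U 2)) := Measure.isProbabilityMeasure_map (hmU 2).aemeasurable
  set ρ : ℝ := (1 / 2 : ℝ) * Real.exp (-(|β'| * (4 * (Fintype.card (Plaquette 3 L) : ℝ)))) with hρdef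
  have hρ : 0 ≤ ρ := by rw [hρdef]; positivity
  have ht₀' : Real.log (Real.log D) ≤ 4 * ρ * t₀ := by rw [hlogD]; exact ht₀
  have hE2 : ∫ ω, φ (U (2 + t₀ + u) ω) ∂P = ∫ y, (∫ y', φ y' ∂(κ (t₀ + u) y)) ∂(P.map (U 2)) := by
    rw [← integral_map (hmU _).aemeasurable hφ.aestronglyMeasurable, ← hreal (2 + t₀ + u) z Ω P W hW U hU0 hU, add_assoc,
      chapmanKolmogorov_szz β' κ hreal 2 (t₀ + u), ← hreal 2 z Ω P W hW U hU0 hU]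
    haveI : IsProbabilityMeasure ((κ (t₀ + u) ∘ₖ κ 2) z) := by
      rw [← chapmanKolmogorov_szz β' κ hreal 2 (t₀ + u)]; infer_instance
    exact Kernel.integral_comp (FeynmanKac.integrable_of_measurable_of_abs_le _ hφ hM)
  rw [hE2]
  have hwarm := abs_integral_transition_le_exp_mul_of_warm L β' κ hreal hρ
    (fun g hg => wilson_generatorLogSobolev_explicit L β' g hg) hDe hν ht₀' hφ hM u
  have hconv : ∫ x, |φ x| ^ (2 : ℝ) ∂(wilsonMeasure (d := 3) (L := L) (fundamentalRep (Fin 2)) β') = ∫ x, φ x ^ 2 ∂(wilsonMeasure (d := 3) (L := L) (fundamentalRep (Fin 2)) β') :=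
    integral_congr_ae (ae_of_all _ fun x => by
      show |φ x| ^ (2 : ℝ) = φ x ^ 2
      rw [Real.rpow_two, sq_abs])
  rw [hconv] at hwarm
  exact hwarm

/-- ★★★ **LEZAUD'S BERNSTEIN INEQUALITY FOR TIME AVERAGES AT EVERY `(L, β')`** (explicit Holley–Stroock constants
`λ_L = (3/2)e^{−|β'|·4·#𝒫}`, `ρ_L = ½e^{−|β'|·4·#𝒫}`).  For every `L`, every `β'`, every deterministic start `z`, EVERY strong solution `U`
from `z` on ANY filtered probability space, EVERY bounded continuous `G` with `|G − μ_{β'}G| ≤ b` (`b ≥ 0`) and `Var_{μ_{β'}}(G) ≤ σ²`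
(`σ > 0`), all `t₀, u` with `log B ≤ 4ρ_L t₀`, every `T > 0` and `ε > 0`:

  `P[ T⁻¹ ∫_{(0,T]} G(U_{2+t₀+u+r}) dr − ∫ G dμ_{β'} ≥ ε ] ≤ e · exp(−λ_L·T·ε² / (4σ² + 2bε))`.

HONEST: `λ_L = e^{−O(|β'|L³)}`; only the SHAPE survives outside the high-temperature window.
[cite: Lezaud2001, Theorem 1.1 and Remark 1.2] [cite: DiaconisSaloffcoste1996, Theorem 3.7] -/
theorem coldStart_timeAverage_tail_le_bernstein_explicit (L : ℕ) [NeZero L] (β' : ℝ)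
    (z : GaugeConfig 3 L (Matrix.specialUnitaryGroup (Fin 2) ℂ))
    {Ω : Type} [MeasurableSpace Ω] {P : Measure Ω} [IsProbabilityMeasure P]
    {W : ℝ≥0 → Ω → (Edge 3 L × NoiseIdx 2 → ℝ)} (hW : IsFlatBrownian W P)
    {U : ℝ≥0 → Ω → GaugeConfig 3 L (Matrix.specialUnitaryGroup (Fin 2) ℂ)} (hU0 : ∀ ω, U 0 ω = z)
    (hU : (latticeLangevinDynamics (fundamentalLatticeRep 2) β').IsSolution (fundamentalRep (Fin 2)) hW.natFiltration P W U)
    {G : GaugeConfig 3 L (Matrix.specialUnitaryGroup (Fin 2) ℂ) → ℝ} (hG : Continuous G) {b σ : ℝ} (hb : 0 ≤ b)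
    (hGb : ∀ x, |G x - ∫ y, G y ∂(wilsonMeasure (d := 3) (L := L) (fundamentalRep (Fin 2)) β')| ≤ b) (hσ : 0 < σ) (hσ2 : ∫ x, (G x - ∫ y, G y ∂(wilsonMeasure (d := 3) (L := L) (fundamentalRep (Fin 2)) β')) ^ 2 ∂(wilsonMeasure (d := 3) (L := L) (fundamentalRep (Fin 2)) β') ≤ σ ^ 2)
    (t₀ u : ℝ≥0)
    (ht₀ : Real.log (96 * |β'| * (Fintype.card (Edge 3 L) : ℝ) + 10 * |β'| * (Fintype.card (Plaquette 3 L) : ℝ) + Real.log 2 +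
      (Fintype.card (Edge 3 L) : ℝ) * Real.log (3 / 2)) ≤
        4 * ((1 / 2 : ℝ) * Real.exp (-(|β'| * (4 * (Fintype.card (Plaquette 3 L) : ℝ))))) * t₀)
    {T : ℝ} (hT : 0 < T) {ε : ℝ} (hε : 0 < ε) :
    P.real {ω | ε ≤ T⁻¹ * (∫ r in Ioc 0 T, G (U (2 + t₀ + u + r.toNNReal) ω)) - ∫ y, G y ∂(wilsonMeasure (d := 3) (L := L) (fundamentalRep (Fin 2)) β')} ≤
      Real.exp 1 * Real.exp (-(((3 / 2 : ℝ) * Real.exp (-(|β'| * (4 * (Fintype.card (Plaquette 3 L) : ℝ))))) * T * ε ^ 2 /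
        (4 * σ ^ 2 + 2 * b * ε))) := by
  classical
  haveI := secondCountableTopology_su2
  haveI := borelSpace_config L
  haveI : IsProbabilityMeasure (wilsonMeasure (d := 3) (L := L) (fundamentalRep (Fin 2)) β') :=
    isProbabilityMeasure_wilsonMeasure (d := 3) (L := L) (fundamentalRep (Fin 2)) (continuous_fundamentalRep (Fin 2)) β'
  haveI : IsFiniteMeasure (volume.restrict (Ioc (0 : ℝ) T)) := isFiniteMeasure_restrict.2 measure_Ioc_lt_top.ne
  obtain ⟨κ, hκM, -, hreal⟩ := exists_transitionKernel L β'
  haveI := hκM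
  have hlam : 0 < (3 / 2 : ℝ) * Real.exp (-(|β'| * (4 * (Fintype.card (Plaquette 3 L) : ℝ)))) := by positivity
  set m : ℝ := ∫ y, G y ∂(wilsonMeasure (d := 3) (L := L) (fundamentalRep (Fin 2)) β') with hm
  obtain ⟨M, hM⟩ : ∃ M : ℝ, ∀ x, |G x| ≤ M :=
    ⟨b + |m|, fun x => by
      calc |G x| = |(G x - m) + m| := by ring_nf
        _ ≤ |G x - m| + |m| := abs_add_le _ _
        _ ≤ b + |m| := add_le_add (hGb x) le_rfl⟩
  have hV0 : ∫ x, (G x - m) ∂(wilsonMeasure (d := 3) (L := L) (fundamentalRep (Fin 2)) β') = 0 := by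
    rw [integral_sub (FeynmanKac.integrable_of_measurable_of_abs_le _ hG.measurable hM) (integrable_const m), integral_const, probReal_univ,
      one_smul, ← hm, sub_self]
  have htail := timeIntegral_tail_le_of_gap_of_warm L β' κ hreal hlam (fun hG' _ hM' t => wilson_spectralGap_explicit_measurable L β' κ hreal hG' hM' t)
    z hW hU0 hU (2 + t₀ + u) (Real.exp_pos 1).le (fun hφ _ hφM => coldStart_warmStart_explicit L β' z hW hU0 hU hφ hφM t₀ u ht₀)
    (hG.sub continuous_const) hb hGb hσ hV0 hσ2 hT hε
  -- `T⁻¹ ∫ (G − m) = T⁻¹ ∫ G − m` along the a.s. continuous paths; the events agree almost surely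
  have hae : {ω | ε ≤ T⁻¹ * (∫ r in Ioc 0 T, G (U (2 + t₀ + u + r.toNNReal) ω)) - m} =ᵐ[P]
      {ω | ε ≤ T⁻¹ * ∫ r in Ioc 0 T, (G (U (2 + t₀ + u + r.toNNReal) ω) - m)} := by
    refine Filter.eventuallyEq_set.2 ?_
    filter_upwards [hU.continuous] with ω hω
    have hg : Continuous fun r : ℝ => G (U (2 + t₀ + u + r.toNNReal) ω) :=
      hG.comp (hω.comp (continuous_const.add continuous_real_toNNReal))
    have hgi : IntegrableOn (fun r : ℝ => G (U (2 + t₀ + u + r.toNNReal) ω)) (Ioc 0 T) volume :=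
      (hg.integrableOn_Icc (a := 0) (b := T)).mono_set Ioc_subset_Icc_self
    have hsplit : ∫ r in Ioc 0 T, (G (U (2 + t₀ + u + r.toNNReal) ω) - m) = (∫ r in Ioc 0 T, G (U (2 + t₀ + u + r.toNNReal) ω)) - T * m := by
      rw [integral_sub hgi (integrable_const m), setIntegral_const, Real.volume_real_Ioc_of_le hT.le, sub_zero, smul_eq_mul]
    rw [hsplit, mul_sub, ← mul_assoc, inv_mul_cancel₀ hT.ne', one_mul]
  rw [measureReal_congr hae]
  exact htail

end Summit.QuantumFields.YangMills.Theorems.ColdStartUniversality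

end
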